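import Literature.NumberTheory.Sieve.SmoothParityModelCount
import HarnessLib

/-!
# The model count of the parity ternary problem: positivity and the plateau lower bound

Topic `Literature/NumberTheory/Sieve`, namespace `Literature.NumberTheory.Sieve.SmoothArcs`; a PROVED tool file for the
circle-method engine of `SmoothParityTernary` ([Harper2016, §5]), sequel of `SmoothParityModelCount` (notation `MC =
parityModelCount …`, `SUB_t` = its sublattice sum over `t ∣ n₁, n₂, n₃`, `μ_i` the model weights).  For REAL NONNEGATIVE
profiles (`im p_{c_i} = 0`, `re p_{c_i} ≥ 0`), `Mv_i ≥ 0`, `X_i ≥ 0`: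

* (MC3) `parityModelCount_im`, `parityModelCount_re_nonneg`, `parityModel_sublattice_im`,
  `parityModel_sublattice_re_nonneg_le` (`0 ≤ re SUB_t ≤ re MC`: drop the terms off the sublattice);
* the PLATEAU LOWER BOUND `le_parityModelCount_re`: if `p_{c_i} = 1` on `[a_i, b_i]` (`0 < a₃`, `b₃ ≤ 1`, `α ≤ 1`) and
  the cores `a_iX_i ≤ n_i ≤ b_iX_i` (`i = 1,2`) are compatible (`a₃X₃ ≤ d₁n₁ + σd₂n₂ ≤ b₃X₃` there), then
  `re MC ≥ (ΠMv_i/X_i) · #core₁ · #core₂`; with `sub_mul_sub_one_le_card_core` (`#core ≥ (b−a)X − 1`) this gives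
  `le_parityModelCount_re_of_plateau`: `re MC ≥ (ΠMv_i/X_i)((b₁−a₁)X₁ − 1)((b₂−a₂)X₂ − 1)` (`0 < a_i`, `b_i ≤ 1`,
  `(b₂−a₂)X₂ ≥ 1`).

## References

* A. J. Harper, Compositio Math. 152 (2016), §5 [Harper2016].
-/

noncomputable section

open Finset

namespace Literature.NumberTheory.Sieve

namespace SmoothArcs

variable {c₁ c₂ c₃ : ℤ → ℂ}

/-! ### (MC3) Real nonnegative profiles: realness, positivity, monotonicity, lower bound -/

/-- **(MC3) Realness of the model count** for real profiles. [folklore] -/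
theorem parityModelCount_im (hreal₁ : ∀ v, (profileFn c₁ v).im = 0) (hreal₂ : ∀ v, (profileFn c₂ v).im = 0)
    (hreal₃ : ∀ v, (profileFn c₃ v).im = 0) (σ : ℤ) (d₁ d₂ : ℕ) (X₁ X₂ X₃ Mv₁ Mv₂ Mv₃ α : ℝ) :
    (parityModelCount σ d₁ d₂ X₁ X₂ X₃ Mv₁ Mv₂ Mv₃ α c₁ c₂ c₃).im = 0 := by
  unfold parityModelCount
  rw [parityModel_tripleSum_eq_ofReal hreal₁ hreal₂ hreal₃, Complex.ofReal_im]

/-- **(MC3) Positivity of the model count** for real nonnegative profiles (`Mv_i ≥ 0`, `X_i ≥ 0`). [folklore] -/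
theorem parityModelCount_re_nonneg (hreal₁ : ∀ v, (profileFn c₁ v).im = 0)
    (hreal₂ : ∀ v, (profileFn c₂ v).im = 0) (hreal₃ : ∀ v, (profileFn c₃ v).im = 0)
    (hpos₁ : ∀ v, 0 ≤ (profileFn c₁ v).re) (hpos₂ : ∀ v, 0 ≤ (profileFn c₂ v).re)
    (hpos₃ : ∀ v, 0 ≤ (profileFn c₃ v).re) (σ : ℤ) (d₁ d₂ : ℕ) {X₁ X₂ X₃ Mv₁ Mv₂ Mv₃ : ℝ} (hMv₁ : 0 ≤ Mv₁)
    (hMv₂ : 0 ≤ Mv₂) (hMv₃ : 0 ≤ Mv₃) (hX₁ : 0 ≤ X₁) (hX₂ : 0 ≤ X₂) (hX₃ : 0 ≤ X₃) (α : ℝ) :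
    0 ≤ (parityModelCount σ d₁ d₂ X₁ X₂ X₃ Mv₁ Mv₂ Mv₃ α c₁ c₂ c₃).re := by
  unfold parityModelCount
  rw [parityModel_tripleSum_eq_ofReal hreal₁ hreal₂ hreal₃, Complex.ofReal_re]
  exact Finset.sum_nonneg fun n₁ _ => Finset.sum_nonneg fun n₂ _ => Finset.sum_nonneg fun n₃ _ =>
    parityModel_summand_re_nonneg hpos₁ hpos₂ hpos₃ σ d₁ d₂ hMv₁ hMv₂ hMv₃ hX₁ hX₂ hX₃ α _ _ _

/-- **(MC3) Realness of the sublattice sum** for real profiles. [folklore] -/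
theorem parityModel_sublattice_im (hreal₁ : ∀ v, (profileFn c₁ v).im = 0)
    (hreal₂ : ∀ v, (profileFn c₂ v).im = 0) (hreal₃ : ∀ v, (profileFn c₃ v).im = 0) (t : ℕ) (σ : ℤ)
    (d₁ d₂ : ℕ) (X₁ X₂ X₃ Mv₁ Mv₂ Mv₃ α : ℝ) :
    (∑ n₁ ∈ (Icc 1 ⌊X₁⌋₊).filter (t ∣ ·), ∑ n₂ ∈ (Icc 1 ⌊X₂⌋₊).filter (t ∣ ·),
      ∑ n₃ ∈ (Icc 1 ⌊X₃⌋₊).filter (t ∣ ·),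
        if (d₁ * n₁ : ℤ) + σ * (d₂ * n₂) = n₃ then
          profileModelWeight c₁ Mv₁ X₁ α n₁ * profileModelWeight c₂ Mv₂ X₂ α n₂ *
            starRingEnd ℂ (profileModelWeight c₃ Mv₃ X₃ α n₃)
        else 0).im = 0 := by
  rw [parityModel_tripleSum_eq_ofReal hreal₁ hreal₂ hreal₃, Complex.ofReal_im]

/-- **(MC3) The sublattice sum is dominated by the full count** (real nonnegative profiles, `Mv_i ≥ 0`,
`X_i ≥ 0`): `0 ≤ re SUB_t ≤ re parityModelCount` (drop the terms off the sublattice). [folklore] -/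
theorem parityModel_sublattice_re_nonneg_le (hreal₁ : ∀ v, (profileFn c₁ v).im = 0)
    (hreal₂ : ∀ v, (profileFn c₂ v).im = 0) (hreal₃ : ∀ v, (profileFn c₃ v).im = 0)
    (hpos₁ : ∀ v, 0 ≤ (profileFn c₁ v).re) (hpos₂ : ∀ v, 0 ≤ (profileFn c₂ v).re)
    (hpos₃ : ∀ v, 0 ≤ (profileFn c₃ v).re) (t : ℕ) (σ : ℤ) (d₁ d₂ : ℕ) {X₁ X₂ X₃ Mv₁ Mv₂ Mv₃ : ℝ}
    (hMv₁ : 0 ≤ Mv₁) (hMv₂ : 0 ≤ Mv₂) (hMv₃ : 0 ≤ Mv₃) (hX₁ : 0 ≤ X₁) (hX₂ : 0 ≤ X₂) (hX₃ : 0 ≤ X₃) (α : ℝ) :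
    0 ≤ (∑ n₁ ∈ (Icc 1 ⌊X₁⌋₊).filter (t ∣ ·), ∑ n₂ ∈ (Icc 1 ⌊X₂⌋₊).filter (t ∣ ·),
          ∑ n₃ ∈ (Icc 1 ⌊X₃⌋₊).filter (t ∣ ·),
            if (d₁ * n₁ : ℤ) + σ * (d₂ * n₂) = n₃ then
              profileModelWeight c₁ Mv₁ X₁ α n₁ * profileModelWeight c₂ Mv₂ X₂ α n₂ *
                starRingEnd ℂ (profileModelWeight c₃ Mv₃ X₃ α n₃)
            else 0).re ∧
      (∑ n₁ ∈ (Icc 1 ⌊X₁⌋₊).filter (t ∣ ·), ∑ n₂ ∈ (Icc 1 ⌊X₂⌋₊).filter (t ∣ ·),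
          ∑ n₃ ∈ (Icc 1 ⌊X₃⌋₊).filter (t ∣ ·),
            if (d₁ * n₁ : ℤ) + σ * (d₂ * n₂) = n₃ then
              profileModelWeight c₁ Mv₁ X₁ α n₁ * profileModelWeight c₂ Mv₂ X₂ α n₂ *
                starRingEnd ℂ (profileModelWeight c₃ Mv₃ X₃ α n₃)
            else 0).re ≤
        (parityModelCount σ d₁ d₂ X₁ X₂ X₃ Mv₁ Mv₂ Mv₃ α c₁ c₂ c₃).re := by
  unfold parityModelCount
  rw [parityModel_tripleSum_eq_ofReal hreal₁ hreal₂ hreal₃, parityModel_tripleSum_eq_ofReal hreal₁ hreal₂ hreal₃,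
    Complex.ofReal_re, Complex.ofReal_re]
  have hf := parityModel_summand_re_nonneg hpos₁ hpos₂ hpos₃ σ d₁ d₂ hMv₁ hMv₂ hMv₃ hX₁ hX₂ hX₃ α
  exact ⟨Finset.sum_nonneg fun n₁ _ => Finset.sum_nonneg fun n₂ _ => Finset.sum_nonneg fun n₃ _ => hf _ _ _,
    tripleSum_mono hf (Finset.filter_subset _ _) (Finset.filter_subset _ _) (Finset.filter_subset _ _)⟩

/-- **(MC3) Lower bound by the plateau cores.**  If the profiles are real nonnegative with `p_{c_i} = 1` on
`[a_i, b_i]`, `0 < a₃`, `b₃ ≤ 1`, `α ≤ 1`, and every pair `(n₁, n₂)` of the cores `a_iX_i ≤ n_i ≤ b_iX_i` has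
`a₃X₃ ≤ d₁n₁ + σd₂n₂ ≤ b₃X₃`, then `re parityModelCount ≥ (Mv₁/X₁)(Mv₂/X₂)(Mv₃/X₃) · #core₁ · #core₂`
(each weight is `≥ Mv_i/X_i` on its core, `le_profileModelWeight_re_of_eq_one`). [cite: Harper2016, §5] -/
theorem le_parityModelCount_re (hreal₁ : ∀ v, (profileFn c₁ v).im = 0)
    (hreal₂ : ∀ v, (profileFn c₂ v).im = 0) (hreal₃ : ∀ v, (profileFn c₃ v).im = 0)
    (hpos₁ : ∀ v, 0 ≤ (profileFn c₁ v).re) (hpos₂ : ∀ v, 0 ≤ (profileFn c₂ v).re)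
    (hpos₃ : ∀ v, 0 ≤ (profileFn c₃ v).re) (σ : ℤ) (d₁ d₂ : ℕ) {X₁ X₂ X₃ Mv₁ Mv₂ Mv₃ α : ℝ}
    (hMv₁ : 0 ≤ Mv₁) (hMv₂ : 0 ≤ Mv₂) (hMv₃ : 0 ≤ Mv₃) (hX₁ : 0 < X₁) (hX₂ : 0 < X₂) (hX₃ : 0 < X₃)
    (hα1 : α ≤ 1) {a₁ b₁ a₂ b₂ a₃ b₃ : ℝ} (hp₁ : ∀ v ∈ Set.Icc a₁ b₁, profileFn c₁ v = 1)
    (hp₂ : ∀ v ∈ Set.Icc a₂ b₂, profileFn c₂ v = 1) (hp₃ : ∀ v ∈ Set.Icc a₃ b₃, profileFn c₃ v = 1)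
    (ha₃ : 0 < a₃) (hb₃ : b₃ ≤ 1)
    (hcomp : ∀ n₁ n₂ : ℕ, a₁ * X₁ ≤ n₁ → (n₁ : ℝ) ≤ b₁ * X₁ → a₂ * X₂ ≤ n₂ → (n₂ : ℝ) ≤ b₂ * X₂ →
      a₃ * X₃ ≤ (d₁ * n₁ : ℝ) + σ * (d₂ * n₂) ∧ (d₁ * n₁ : ℝ) + σ * (d₂ * n₂) ≤ b₃ * X₃) :
    Mv₁ / X₁ * (Mv₂ / X₂) * (Mv₃ / X₃) *
        (((Icc 1 ⌊X₁⌋₊).filter (fun n : ℕ => a₁ * X₁ ≤ n ∧ (n : ℝ) ≤ b₁ * X₁)).card *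
          ((Icc 1 ⌊X₂⌋₊).filter (fun n : ℕ => a₂ * X₂ ≤ n ∧ (n : ℝ) ≤ b₂ * X₂)).card) ≤
      (parityModelCount σ d₁ d₂ X₁ X₂ X₃ Mv₁ Mv₂ Mv₃ α c₁ c₂ c₃).re := by
  unfold parityModelCount
  rw [parityModel_tripleSum_eq_ofReal hreal₁ hreal₂ hreal₃, Complex.ofReal_re]
  have hf := parityModel_summand_re_nonneg hpos₁ hpos₂ hpos₃ σ d₁ d₂ hMv₁ hMv₂ hMv₃ hX₁.le hX₂.le hX₃.le α
  set C₁ := (Icc 1 ⌊X₁⌋₊).filter (fun n : ℕ => a₁ * X₁ ≤ n ∧ (n : ℝ) ≤ b₁ * X₁) with hC₁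
  set C₂ := (Icc 1 ⌊X₂⌋₊).filter (fun n : ℕ => a₂ * X₂ ≤ n ∧ (n : ℝ) ≤ b₂ * X₂) with hC₂
  calc Mv₁ / X₁ * (Mv₂ / X₂) * (Mv₃ / X₃) * (C₁.card * C₂.card)
      = ∑ n₁ ∈ C₁, ∑ n₂ ∈ C₂, Mv₁ / X₁ * (Mv₂ / X₂) * (Mv₃ / X₃) := by
        simp only [Finset.sum_const, nsmul_eq_mul]
        ring
    _ ≤ ∑ n₁ ∈ C₁, ∑ n₂ ∈ C₂, ∑ n₃ ∈ Icc 1 ⌊X₃⌋₊,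
          (if (d₁ * n₁ : ℤ) + σ * (d₂ * n₂) = n₃ then
            (profileModelWeight c₁ Mv₁ X₁ α n₁).re * (profileModelWeight c₂ Mv₂ X₂ α n₂).re *
              (profileModelWeight c₃ Mv₃ X₃ α n₃).re
          else 0 : ℝ) := by
        refine Finset.sum_le_sum fun n₁ hn₁ => Finset.sum_le_sum fun n₂ hn₂ => ?_
        obtain ⟨-, ha₁, hb₁⟩ := Finset.mem_filter.mp hn₁
        obtain ⟨-, ha₂, hb₂⟩ := Finset.mem_filter.mp hn₂
        obtain ⟨h3a, h3b⟩ := hcomp n₁ n₂ ha₁ hb₁ ha₂ hb₂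
        set s : ℤ := (d₁ * n₁ : ℤ) + σ * (d₂ * n₂) with hs
        have hsR : (s : ℝ) = (d₁ * n₁ : ℝ) + σ * (d₂ * n₂) := by rw [hs]; push_cast; ring
        have hs0 : 0 < s := by
          have h : (0 : ℝ) < s := by rw [hsR]; exact lt_of_lt_of_le (mul_pos ha₃ hX₃) h3a
          exact_mod_cast h
        have hsN : ((s.toNat : ℕ) : ℝ) = (s : ℝ) := by
          have h := Int.toNat_of_nonneg hs0.le
          exact_mod_cast congrArg (fun z : ℤ => (z : ℝ)) h
        have hsX : (s : ℝ) ≤ X₃ := by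
          rw [hsR]
          exact h3b.trans (by nlinarith)
        have hmem : s.toNat ∈ Icc 1 ⌊X₃⌋₊ := by
          refine Finset.mem_Icc.mpr ⟨by omega, Nat.le_floor ?_⟩
          rw [hsN]
          exact hsX
        refine le_trans ?_ (Finset.single_le_sum (fun n₃ _ => hf n₁ n₂ n₃) hmem)
        rw [if_pos (by rw [hs]; omega)]
        have hw₁ : Mv₁ / X₁ ≤ (profileModelWeight c₁ Mv₁ X₁ α n₁).re :=
          le_profileModelWeight_re_of_eq_one hMv₁ hX₁ hα1 hp₁ ((le_div_iff₀ hX₁).mpr ha₁)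
            ((div_le_iff₀ hX₁).mpr hb₁)
        have hw₂ : Mv₂ / X₂ ≤ (profileModelWeight c₂ Mv₂ X₂ α n₂).re :=
          le_profileModelWeight_re_of_eq_one hMv₂ hX₂ hα1 hp₂ ((le_div_iff₀ hX₂).mpr ha₂)
            ((div_le_iff₀ hX₂).mpr hb₂)
        have hw₃ : Mv₃ / X₃ ≤ (profileModelWeight c₃ Mv₃ X₃ α s.toNat).re := by
          refine le_profileModelWeight_re_of_eq_one hMv₃ hX₃ hα1 hp₃ ?_ ?_
          · rw [hsN, le_div_iff₀ hX₃, hsR]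
            exact h3a
          · rw [hsN, div_le_iff₀ hX₃, hsR]
            exact h3b
        exact mul_le_mul (mul_le_mul hw₁ hw₂ (div_nonneg hMv₂ hX₂.le) ((div_nonneg hMv₁ hX₁.le).trans hw₁))
          hw₃ (div_nonneg hMv₃ hX₃.le)
          (mul_nonneg ((div_nonneg hMv₁ hX₁.le).trans hw₁) ((div_nonneg hMv₂ hX₂.le).trans hw₂))
    _ ≤ _ := tripleSum_mono hf (Finset.filter_subset _ _) (Finset.filter_subset _ _) (Finset.Subset.refl _)

/-- **Size of a core**: for `X > 0`, `0 < a`, `b ≤ 1`, the integers `n` with `aX ≤ n ≤ bX` (all in `[1, ⌊X⌋]`)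
number at least `(b − a)X − 1`. [folklore] -/
theorem sub_mul_sub_one_le_card_core {X a b : ℝ} (hX : 0 < X) (ha : 0 < a) (hb : b ≤ 1) :
    (b - a) * X - 1 ≤ (((Icc 1 ⌊X⌋₊).filter (fun n : ℕ => a * X ≤ n ∧ (n : ℝ) ≤ b * X)).card : ℝ) := by
  rcases le_or_gt ((b - a) * X - 1) 0 with h | h
  · exact h.trans (Nat.cast_nonneg _)
  · have haX : 0 < a * X := mul_pos ha hX
    have hbX : 0 ≤ b * X := by nlinarith
    have hsub : Icc ⌈a * X⌉₊ ⌊b * X⌋₊ ⊆ (Icc 1 ⌊X⌋₊).filter (fun n : ℕ => a * X ≤ n ∧ (n : ℝ) ≤ b * X) := by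
      intro n hn
      rw [Finset.mem_Icc] at hn
      have h1 : a * X ≤ n := Nat.ceil_le.mp hn.1
      have h2 : (n : ℝ) ≤ b * X := (Nat.le_floor_iff hbX).mp hn.2
      refine Finset.mem_filter.mpr ⟨Finset.mem_Icc.mpr ⟨?_, ?_⟩, h1, h2⟩
      · have h3 : (0 : ℝ) < n := haX.trans_le h1
        exact Nat.one_le_iff_ne_zero.mpr (by rintro rfl; simp at h3)
      · exact Nat.le_floor (h2.trans (by nlinarith))
    have hc : (⌈a * X⌉₊ : ℝ) < a * X + 1 := Nat.ceil_lt_add_one haX.le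
    have hfl : b * X < ⌊b * X⌋₊ + 1 := Nat.lt_floor_add_one _
    have hle : ⌈a * X⌉₊ ≤ ⌊b * X⌋₊ + 1 := by
      have h' : (⌈a * X⌉₊ : ℝ) < ⌊b * X⌋₊ + 1 := by linarith
      exact_mod_cast h'.le
    calc (b - a) * X - 1 ≤ ((Icc ⌈a * X⌉₊ ⌊b * X⌋₊).card : ℝ) := by
          rw [Nat.card_Icc, Nat.cast_sub hle]
          push_cast
          linarith
      _ ≤ _ := by exact_mod_cast Finset.card_le_card hsub

/-- **(MC3) Lower bound, explicit form**: under the hypotheses of `le_parityModelCount_re` and `0 < a_i`,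
`b_i ≤ 1` (`i = 1, 2`), `(b₂ − a₂) X₂ ≥ 1` (so that the second factor below is `≥ 0`; `#core_i ≥ (b_i − a_i)X_i − 1`):
`(Mv₁/X₁)(Mv₂/X₂)(Mv₃/X₃) ((b₁−a₁)X₁ − 1)((b₂−a₂)X₂ − 1) ≤ re parityModelCount`. [cite: Harper2016, §5] -/
theorem le_parityModelCount_re_of_plateau (hreal₁ : ∀ v, (profileFn c₁ v).im = 0)
    (hreal₂ : ∀ v, (profileFn c₂ v).im = 0) (hreal₃ : ∀ v, (profileFn c₃ v).im = 0)
    (hpos₁ : ∀ v, 0 ≤ (profileFn c₁ v).re) (hpos₂ : ∀ v, 0 ≤ (profileFn c₂ v).re)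
    (hpos₃ : ∀ v, 0 ≤ (profileFn c₃ v).re) (σ : ℤ) (d₁ d₂ : ℕ) {X₁ X₂ X₃ Mv₁ Mv₂ Mv₃ α : ℝ}
    (hMv₁ : 0 ≤ Mv₁) (hMv₂ : 0 ≤ Mv₂) (hMv₃ : 0 ≤ Mv₃) (hX₁ : 0 < X₁) (hX₂ : 0 < X₂) (hX₃ : 0 < X₃)
    (hα1 : α ≤ 1) {a₁ b₁ a₂ b₂ a₃ b₃ : ℝ} (hp₁ : ∀ v ∈ Set.Icc a₁ b₁, profileFn c₁ v = 1)
    (hp₂ : ∀ v ∈ Set.Icc a₂ b₂, profileFn c₂ v = 1) (hp₃ : ∀ v ∈ Set.Icc a₃ b₃, profileFn c₃ v = 1)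
    (ha₁ : 0 < a₁) (hb₁ : b₁ ≤ 1) (ha₂ : 0 < a₂) (hb₂ : b₂ ≤ 1) (ha₃ : 0 < a₃) (hb₃ : b₃ ≤ 1)
    (hab₂ : 1 ≤ (b₂ - a₂) * X₂)
    (hcomp : ∀ n₁ n₂ : ℕ, a₁ * X₁ ≤ n₁ → (n₁ : ℝ) ≤ b₁ * X₁ → a₂ * X₂ ≤ n₂ → (n₂ : ℝ) ≤ b₂ * X₂ →
      a₃ * X₃ ≤ (d₁ * n₁ : ℝ) + σ * (d₂ * n₂) ∧ (d₁ * n₁ : ℝ) + σ * (d₂ * n₂) ≤ b₃ * X₃) :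
    Mv₁ / X₁ * (Mv₂ / X₂) * (Mv₃ / X₃) * (((b₁ - a₁) * X₁ - 1) * ((b₂ - a₂) * X₂ - 1)) ≤
      (parityModelCount σ d₁ d₂ X₁ X₂ X₃ Mv₁ Mv₂ Mv₃ α c₁ c₂ c₃).re := by
  refine le_trans ?_ (le_parityModelCount_re hreal₁ hreal₂ hreal₃ hpos₁ hpos₂ hpos₃ σ d₁ d₂ hMv₁ hMv₂ hMv₃
    hX₁ hX₂ hX₃ hα1 hp₁ hp₂ hp₃ ha₃ hb₃ hcomp)
  have hP : 0 ≤ Mv₁ / X₁ * (Mv₂ / X₂) * (Mv₃ / X₃) := by positivity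
  refine mul_le_mul_of_nonneg_left (mul_le_mul (sub_mul_sub_one_le_card_core hX₁ ha₁ hb₁)
    (sub_mul_sub_one_le_card_core hX₂ ha₂ hb₂) (by linarith) (Nat.cast_nonneg _)) hP

end SmoothArcs

end Literature.NumberTheory.Sieve

end
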